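/-
Origin: expansion seat `planner-pub-hodgecm-mc-axioms-1-g14-0`, handover #W65 2026-08-20T15:53:55Z md5 7b6932f26afa (PKG 6fe14f4820c7 → 7b6932f26afa; 234 l.; MECHANICAL (iib-R) rewrite v3.1 of the PKG file as it stands (27 token edits; rules R1x2+RX[h₂]x20+RX[h₂']x5)) (`HOME/mc/pub-hodgecm-mc-axioms-1-g14/revendor/kit-r55/stage55/HodgeCM/Model/ThetaHolDirections.lean`, md5 7b6932f26afa, 234 lines);
landed by the gen-22 packager (p-g22) in gate run 55 REPLACES the earlier landed copy of `HodgeCM/Model/ThetaHolDirections.lean` (seat copy carried the packager Origin header of an earlier run (stripped)).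
-/
/-
Copyright (c) 2026. Released under Apache 2.0 license as described in the file LICENSE.
Cell pub-hodgecm, MODEL layer (construction prover mc-theta-3, gen 4), node W6b-hol (ASM) of `MODEL-DAG.md`:
reduction of the `𝔭₋`-annihilation hypothesis (REP) to the two coordinate directions of `𝔭 ≅ ℂ²`.
-/
import Summits.HodgeConjecture.HodgeCM.Model.ThetaHolAssembly_2

/-!
# Holomorphy of the restricted theta forms: coordinate directions suffice (W6b-hol, ASM — pin side)

`Model/ThetaHolAssembly` assembles E's binder `hol` from (H1) on the adelic side and, on the archimedean
`K`-type datum `B`, (AN) `B.IsWeaklyPDiff e` and (REP) `B.IsPMinusKilled e` — the latter asking, for EVERY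
direction `v` of the chart domain, difference-quotient limits `D`, `Dᵢ` along `t ↦ e (t v)`, `t ↦ e (t iv)` with
`D + i Dᵢ = 0`.

This file records the elementary reduction used at the pin `e = expP : ℂ² → U(2,1)`: since (AN) makes the
scalarised differential `L := fderiv ℝ (b ↦ T (ω_∞(e b) Φ_∞(ℓ))) 0` a REAL-LINEAR map on `ℂ²`, its complex-linearity
`L (iv) = i L v` for all `v` follows from the two instances `v = c_p e_p` (`p = 0, 1`, any `c_p ≠ 0`)
(`ThetaHolDirections.apply_I_smul_of_basis`: the set where a real-linear map into a complex vector space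
commutes with `i` is a complex subspace).  Hence (REP) is only needed ALONG the two directions `c_p e_p`
(`ArchKTypeData.IsPMinusKilledAlong`), which for `c_p = -i` are exactly the one-parameter subgroups
`t ↦ expP ((-i t) e_p)` (the rank-one hyperbolic subgroups of the junction frame) and `t ↦ expP (t e_p)` (the real
symmetric boosts) over which the representation-theoretic symbol formulas are stated.

Main results: `ArchKTypeData.isWeaklyCR_of_isPMinusKilledAlong` (generic `X`),
**`ArchKTypeData.hol_of_isPMinusKilledAlong`** (E's `hol` at the pin, per `(V, c, k, N)`, from (H1), (AN) and
(REP) along `-i e_0`, `-i e_1` only) and the END-STATE corollary **`classPacksOf_pin_of_isPMinusKilledAlong`**.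

Nothing is cited and nothing is minted: kernel lemmas over the installed definitions.
-/

set_option autoImplicit false

noncomputable section

open Filter Topology
open scoped Classical SchwartzMap
open MulAction NumberField.mixedEmbedding
open Literature.Geometry.ComplexHyperbolic.BallModel (U21 Ball x₀)
open Literature.NumberTheory.Automorphic Literature.NumberTheory.Weil1964
open Literature.AlgebraicGeometry.HodgeTheory
open Literature.AlgebraicGeometry.ShimuraVarieties
open Literature.NumberTheory.Automorphic.PicardCM
open HodgeCM.PerL34.Seesaw HodgeCM.PerL34.RationalCoset HodgeCM.PerL34.SupplyAdelic
open HodgeCM.Model.SupplyInstance HodgeCM.Model.SupplyResidual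
open HodgeCM.Model.ThetaSpace

namespace HodgeCM
namespace Model

/-! ### § 1. Linear algebra: commuting with `i` on a complex basis -/

namespace ThetaHolDirections

section LinearAlgebra

variable {F : Type*} [AddCommGroup F] [Module ℂ F] [Module ℝ F] [IsScalarTower ℝ ℂ F]
variable {E : Type*} [AddCommGroup E] [Module ℂ E] [Module ℝ E] [IsScalarTower ℝ ℂ E]

/-- If a real-linear map `L` into a complex vector space commutes with `i` at `w`, it commutes with `i` on the
complex line through `w`. -/
theorem apply_I_smul_smul (L : E →ₗ[ℝ] F) {w : E} (hw : L (Complex.I • w) = Complex.I • L w) (z : ℂ) :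
    L (Complex.I • (z • w)) = Complex.I • L (z • w) := by
  have hre : ∀ (r : ℝ) (x : E), (r : ℂ) • x = r • x := fun r x => algebraMap_smul ℂ r x
  have hz : z • w = z.re • w + z.im • (Complex.I • w) := by
    conv_lhs => rw [← Complex.re_add_im z]
    rw [add_smul, mul_smul, hre, hre]
  have hI2 : Complex.I • (Complex.I • w) = -w := by rw [smul_smul, Complex.I_mul_I, neg_one_smul]
  have hI2' : Complex.I • (Complex.I • L w) = -L w := by rw [smul_smul, Complex.I_mul_I, neg_one_smul]
  rw [hz, smul_add, smul_comm Complex.I z.re w, smul_comm Complex.I z.im (Complex.I • w), hI2, smul_neg, map_add,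
    map_add, map_neg, L.map_smul z.re, L.map_smul z.re, L.map_smul z.im, L.map_smul z.im, hw, smul_add,
    smul_comm Complex.I z.re (L w), smul_comm Complex.I z.im (Complex.I • L w), hI2', smul_neg]

/-- **Commuting with `i` on a basis suffices** (`ℂ²`): a real-linear map `L : ℂ² → F` with
`L (i c_p e_p) = i L (c_p e_p)` for `p = 0, 1` (`c_p ≠ 0`) satisfies `L (iv) = i L v` for every `v`. -/
theorem apply_I_smul_of_basis (L : (Fin 2 → ℂ) →ₗ[ℝ] F) (c : Fin 2 → ℂ) (hc : ∀ p, c p ≠ 0)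
    (h : ∀ p, L (Complex.I • (c p • (Pi.single p 1 : Fin 2 → ℂ))) =
      Complex.I • L (c p • (Pi.single p 1 : Fin 2 → ℂ))) (v : Fin 2 → ℂ) :
    L (Complex.I • v) = Complex.I • L v := by
  have hv : v = (v 0 / c 0) • (c 0 • (Pi.single 0 1 : Fin 2 → ℂ)) +
      (v 1 / c 1) • (c 1 • (Pi.single 1 1 : Fin 2 → ℂ)) := by
    ext i
    fin_cases i <;> simp [hc]
  rw [hv, smul_add, map_add, map_add, smul_add, apply_I_smul_smul L (h 0), apply_I_smul_smul L (h 1)]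

end LinearAlgebra

end ThetaHolDirections

/-! ### § 2. (REP) along the coordinate directions -/

section ArchDirections

variable {U : Universe} {Lc : CMField} {ι₁ : Lc →+* ℂ} {V : HermSpace3 Lc ι₁} {c : SeesawCtx Lc}

namespace ArchKTypeData

variable {X : ThetaSpaceInput U V c} {k : Fin 4} {N : ℕ} (B : ArchKTypeData X k N)

/-- **(REP) along one direction `v`**: for every covector `ℓ`, along `t ↦ e (t v)` and `t ↦ e (t iv)` the vectors
`ω_∞(·) Φ_∞(ℓ)` have difference-quotient limits `D`, `Dᵢ` in `𝒮` with `D + i Dᵢ = 0`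
(`B.IsPMinusKilled e ↔ ∀ v, B.IsPMinusKilledAlong e v`). -/
def IsPMinusKilledAlong {P' : Type*} [NormedAddCommGroup P'] [NormedSpace ℝ P'] [Module ℂ P'] (e : P' → X.G₁)
    (v : P') : Prop :=
  ∀ ℓ : Module.Dual ℂ X.W, ∃ D Dᵢ : 𝓢((X.J → mixedSpace X.K), ℂ),
    Tendsto (fun t : ℝ => t⁻¹ • (B.ωinf (e (t • v)) (B.Φarch ℓ) - B.Φarch ℓ)) (𝓝[≠] 0) (𝓝 D) ∧
      Tendsto (fun t : ℝ => t⁻¹ • (B.ωinf (e (t • (Complex.I • v))) (B.Φarch ℓ) - B.Φarch ℓ)) (𝓝[≠] 0)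
        (𝓝 Dᵢ) ∧ D + Complex.I • Dᵢ = 0

/-- (Ported verbatim from the HodgeCMPerL package; no docstring in the source.) -/
theorem isPMinusKilled_iff {P' : Type*} [NormedAddCommGroup P'] [NormedSpace ℝ P'] [Module ℂ P']
    (e : P' → X.G₁) : B.IsPMinusKilled e ↔ ∀ v, B.IsPMinusKilledAlong e v :=
  Iff.rfl

/-- **(AN) + (REP) along `c_0 e_0`, `c_1 e_1` ⇒ (REP′)** for a chart `e : ℂ² → G₁` with `e 0 = 1`: the
scalarised differentials are complex-linear (§ 1 applied to `fderiv`, whose values on `i c_p e_p` are computed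
by `ThetaHolAssembly.fderiv_I_smul_of_slopes`). -/
theorem isWeaklyCR_of_isPMinusKilledAlong {e : (Fin 2 → ℂ) → X.G₁} (he : e 0 = 1) (hd : B.IsWeaklyPDiff e)
    (c : Fin 2 → ℂ) (hc : ∀ p, c p ≠ 0) (hk : ∀ p, B.IsPMinusKilledAlong e (c p • (Pi.single p 1 : Fin 2 → ℂ))) :
    B.IsWeaklyCR e := by
  intro T ℓ v
  have h0 : B.ωinf (e 0) (B.Φarch ℓ) = B.Φarch ℓ := by rw [he, map_one, Module.End.one_apply]
  refine ThetaHolDirections.apply_I_smul_of_basis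
    ((fderiv ℝ (fun b => T (B.ωinf (e b) (B.Φarch ℓ))) 0).toLinearMap) c hc (fun p => ?_) v
  obtain ⟨D, Dᵢ, hD, hDᵢ, hsum⟩ := hk p ℓ
  exact ThetaHolAssembly.fderiv_I_smul_of_slopes T (Ψ := fun b => B.ωinf (e b) (B.Φarch ℓ)) (hd T ℓ) _
    (by simpa only [h0] using hD) (by simpa only [h0] using hDᵢ) hsum

end ArchKTypeData

end ArchDirections

/-! ### § 3. E's `hol` at the pin from (REP) along `-i e_0`, `-i e_1` -/

section PinHol

variable (hHD : exists_isReal_hodgeModel) (hI : hodgePQ_independent_of_hodgeModel)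
  (h₁ : BallQuotientUniformised)  (h₃ : CMAbelianVarietyRealised)

variable {L : CMField} {ι₁ : L →+* ℂ} {V : HermSpace3 L ι₁} {c : SeesawCtx L}

/-- The two directions `t ↦ t • (-i e_p)` and `t ↦ t • (i (-i e_p))` of `IsPMinusKilledAlong expP (-i e_p)` are
the one-parameter families `expP ((-i t) e_p)` and `expP (t e_p)`. -/
theorem ThetaHolDirections.smul_negI_single (p : Fin 2) (t : ℝ) :
    t • (-Complex.I • (Pi.single p 1 : Fin 2 → ℂ)) = (-Complex.I * (t : ℂ)) • (Pi.single p 1 : Fin 2 → ℂ) ∧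
      t • (Complex.I • (-Complex.I • (Pi.single p 1 : Fin 2 → ℂ))) = (t : ℂ) • (Pi.single p 1 : Fin 2 → ℂ) := by
  have hre : ∀ x : Fin 2 → ℂ, t • x = (t : ℂ) • x := fun x => (algebraMap_smul ℂ t x).symm
  refine ⟨?_, ?_⟩
  · rw [hre, smul_smul, mul_comm]
  · rw [smul_smul, show Complex.I * -Complex.I = 1 by simp, one_smul, hre]

/-- **E's `hol` at the pin, per `(V, c, k, N)`, from (REP) along the coordinate directions** (node W6b-hol,
(ASM)): (H1) continuity of the archimedean theta functionals of `S.P k`, (AN) weak differentiability of the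
boost orbits and (REP) ALONG `-i e_0`, `-i e_1` ONLY — i.e. along the one-parameter subgroups
`t ↦ expP ((-i t) e_p)` and `t ↦ expP (t e_p)` — give holomorphy of every restricted theta form. -/
theorem ArchKTypeData.hol_of_isPMinusKilledAlong (S : ThetaAdelicSide V c) (h : IsAnisotropic L V.Hm)
    {k : Fin 4} {N : ℕ} (B : ArchKTypeData (thetaSpaceInputIn hHD hI h₁ h₃ S h) k N)
    (hT : ((thetaSpaceInputIn hHD hI h₁ h₃ S h).P k).IsThetaArchContinuous N)
    (hd : B.IsWeaklyPDiff BallForms.expP)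
    (hk : ∀ p : Fin 2, B.IsPMinusKilledAlong BallForms.expP (-Complex.I • (Pi.single p 1 : Fin 2 → ℂ))) :
    ∀ f ∈ ((thetaSpaceInputIn hHD hI h₁ h₃ S h).P k).weightFunctions,
      B.toProduct.restrictedThetaForm f ∈ ((thetaSpaceInputIn hHD hI h₁ h₃ S h).D B.Γ₀).Hol :=
  B.hol_of_isWeaklyCR hHD hI h₁ h₃ S h hT hd
    (B.isWeaklyCR_of_isPMinusKilledAlong BallForms.expP_zero hd (fun _ => -Complex.I) (fun _ => by simp) hk)

end PinHol

/-! ### § 4. The end-state corollary -/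

section EndState

variable (hHD : exists_isReal_hodgeModel) (hI : hodgePQ_independent_of_hodgeModel)
  (h₁ : BallQuotientUniformised)  (h₃ : CMAbelianVarietyRealised)

/-- **E's `classPacks` over the END STATE from the adelic side `S`, the archimedean `K`-type data `C`, and
the three one-sided hypotheses (H1) `hT`, (AN) `hd`, (REP) `hk` ALONG THE COORDINATE DIRECTIONS `-i e_p`** —
`classPacksOf_pin` with its binder `hol` ASSEMBLED (`ArchKTypeData.hol_of_isPMinusKilledAlong`). -/
theorem classPacksOf_pin_of_isPMinusKilledAlong (h : Bool)
    (emb : ∀ {L : CMField} {ι₁ : L →+* ℂ} {V : HermSpace3 L ι₁} (Γ : Level V),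
      (picardCMUniverse hHD hI h₁ h₃).CohC ((picardCMUniverse hHD hI h₁ h₃).pms L ι₁ V Γ) 2 →ₗ[ℂ]
        (V.latticeModel printFact_unitaryCompact_holds).toQuotientModel.H)
    (cover : ∀ {L : CMField} {ι₁ : L →+* ℂ} {V : HermSpace3 L ι₁} (Γ Γ' : Level V),
      Γ'.Γ ≤ Γ.Γ → (picardCMUniverse hHD hI h₁ h₃).Mor ((picardCMUniverse hHD hI h₁ h₃).pms L ι₁ V Γ')
        ((picardCMUniverse hHD hI h₁ h₃).pms L ι₁ V Γ))
    (wm : ∀ {L : CMField} {ι₁ : L →+* ℂ} (V : HermSpace3 L ι₁) (c : SeesawCtx L),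
      WeilThetaModel (V.latticeModel printFact_unitaryCompact_holds).toQuotientModel.G
        (V.latticeModel printFact_unitaryCompact_holds).toQuotientModel.Γ
        (c.D.latticeModelW printFact_unitaryCompact_holds).toQuotientModel.G
        (c.D.latticeModelW printFact_unitaryCompact_holds).toQuotientModel.Γ)
    (S : ∀ {L : CMField} {ι₁ : L →+* ℂ} (V : HermSpace3 L ι₁) (c : SeesawCtx L), ThetaAdelicSide V c)
    (d12 d34 : ∀ {L : CMField}, SeesawCtx L → HodgeCM.Universe.SideData L)
    (C : ∀ {L : CMField} {ι₁ : L →+* ℂ} (V : HermSpace3 L ι₁) (c : SeesawCtx L) (hV : IsAnisotropic L V.Hm),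
      (thetaModelOf hHD hI h₁ h₃ h emb cover wm
        (thetaOf _ (thetaClassInputOf _ (fun V c => thetaSpaceInputOf hHD hI h₁ h₃ S V c))) d12 d34).GoodCtx
          ι₁ c →
      Module.finrank ℚ c.K = 6 → ∀ k : Fin 4, k = 0 ∨ k = 1 → ∀ N : ℕ, 0 < N →
        ArchKTypeData (thetaSpaceInputIn hHD hI h₁ h₃ (S V c) hV) k N)
    (hT : ∀ {L : CMField} {ι₁ : L →+* ℂ} (V : HermSpace3 L ι₁) (c : SeesawCtx L) (k : Fin 4) (N : ℕ),
      ((S V c).P k).IsThetaArchContinuous N)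
    (hd : ∀ {L : CMField} {ι₁ : L →+* ℂ} (V : HermSpace3 L ι₁) (c : SeesawCtx L) (hV : IsAnisotropic L V.Hm)
      (hc : (thetaModelOf hHD hI h₁ h₃ h emb cover wm
        (thetaOf _ (thetaClassInputOf _ (fun V c => thetaSpaceInputOf hHD hI h₁ h₃ S V c))) d12 d34).GoodCtx
          ι₁ c)
      (h6 : Module.finrank ℚ c.K = 6) (k : Fin 4) (hk : k = 0 ∨ k = 1) (N : ℕ) (hN : 0 < N),
      (C V c hV hc h6 k hk N hN).IsWeaklyPDiff BallForms.expP)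
    (hk : ∀ {L : CMField} {ι₁ : L →+* ℂ} (V : HermSpace3 L ι₁) (c : SeesawCtx L) (hV : IsAnisotropic L V.Hm)
      (hc : (thetaModelOf hHD hI h₁ h₃ h emb cover wm
        (thetaOf _ (thetaClassInputOf _ (fun V c => thetaSpaceInputOf hHD hI h₁ h₃ S V c))) d12 d34).GoodCtx
          ι₁ c)
      (h6 : Module.finrank ℚ c.K = 6) (k : Fin 4) (hk : k = 0 ∨ k = 1) (N : ℕ) (hN : 0 < N) (p : Fin 2),
      (C V c hV hc h6 k hk N hN).IsPMinusKilledAlong BallForms.expP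
        (-Complex.I • (Pi.single p 1 : Fin 2 → ℂ)))
    {L : CMField} {ι₁ : L →+* ℂ} (V : HermSpace3 L ι₁) (c : SeesawCtx L)
    (hc : (thetaModelOf hHD hI h₁ h₃ h emb cover wm
      (thetaOf _ (thetaClassInputOf _ (fun V c => thetaSpaceInputOf hHD hI h₁ h₃ S V c))) d12 d34).GoodCtx
        ι₁ c)
    (h6 : Module.finrank ℚ c.K = 6) :
    Nonempty (ClassSupplyPackN (thetaModelOf hHD hI h₁ h₃ h emb cover wm
        (thetaOf _ (thetaClassInputOf _ (fun V c => thetaSpaceInputOf hHD hI h₁ h₃ S V c))) d12 d34) V c 0) ∧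
      Nonempty (ClassSupplyPackN (thetaModelOf hHD hI h₁ h₃ h emb cover wm
        (thetaOf _ (thetaClassInputOf _ (fun V c => thetaSpaceInputOf hHD hI h₁ h₃ S V c))) d12 d34) V c 1) :=
  classPacksOf_pin hHD hI h₁ h₃ h emb cover wm S d12 d34 C
    (fun V c hV hc h6 k hk' N hN =>
      (C V c hV hc h6 k hk' N hN).hol_of_isPMinusKilledAlong hHD hI h₁ h₃ (S V c) hV (hT V c k N)
        (hd V c hV hc h6 k hk' N hN) (fun p => hk V c hV hc h6 k hk' N hN p))
    V c hc h6

end EndState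

end Model
end HodgeCM
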